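import Mathlib.Analysis.SpecialFunctions.Pow.Asymptotics
import Literature.Probability.Percolation.SitePercolationMeasure
import Literature.Probability.Percolation.SiteConnectionTools
import Literature.Probability.Percolation.CerfTwoArms
import Literature.Probability.Percolation.CerfBoxLRO
import HarnessLib

/-!
# Cerf 2015, Theorem 1.3: the assembly of §10 (proofs)

Topic `Literature/Probability/Percolation`. Sorry-free companion of `CerfBoxLRO.lean` (named facts
`Literature.Probability.Percolation.Cerf2015_thm_1_3`, `Literature.Probability.Percolation.Cerf2015_thm_1_3_three`) and `CerfTwoArms.lean`
(Cerf's numbered intermediate results as named facts). R. Cerf, *A lower bound on the two-arms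
exponent for critical percolation on the lattice*, Ann. Probab. 43 (2015) 2458–2480,
doi:10.1214/14-AOP940, arXiv:1306.3105 (page numbers: the 16-page arXiv rendering).

## Main results

* `Cerf2015_thm_1_3_of_facts : Cerf2015_lem_7_1 → Cerf2015_lem_10_1 →
    Cerf2015_thm_1_1_of_siteTheta_pos → Cerf2015_thm_1_3` — §10 of the paper (p. 15), formalised;
* `Cerf2015_thm_1_3_three_of_facts` — the same for the `d = 3`, `Λ(n^16)` statement.

(Lemma 10.1 itself is proved in `CerfTwoArmsProofs.lean`, `Cerf2015_lem_10_1_holds`, so that only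
Lemma 7.1 and Theorem 1.1 remain as genuine inputs.)

So the two `CerfBoxLRO` facts are reduced to three numbered results of the paper: the two-arms
transfer inequality (Lemma 7.1, used with `k = 0`), the FKG lower bound (Lemma 10.1) and the
two-arms exponent bound (Theorem 1.1, in the form used on p. 15, i.e. at a parameter `p` with
`θ(p) > 0`). Everything else used on p. 15 is proved: the Harris–FKG inequality for local
increasing events (`sitePercolation_harris'`, `SitePercolationMeasure.lean`), the lattice
symmetries, the exit estimate `θ(p) ≤ Σ_{x ∈ ∂ⁱⁿΛ(n)} P(0 ⟷ x in Λ(n))` and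
`|∂ⁱⁿΛ(n)| ≤ 2d(2n+1)^{d−1}` (`SiteConnectionTools.lean`).

## The argument (Cerf 2015, §10, p. 15) as formalised

Fix `d ≥ 2`, `p` with `θ(p) > 0` (hence `p > 0`, `pos_of_siteTheta_pos`) and `α > T(d)`,
`T(d) = (4d²+5d−5)(3d−1)/(2d²+3d−3) = (3d−1)/γ_∞` (`cerf_threshold_eq`). Pick `α₀ = (T(d)+α)/2`
and `γ < γ_∞` with `α₀ γ > 3d − 1` (`exists_gamma`); put `ℓ_n = ⌈n^{α₀}⌉ + 1`.
1. `main_estimate`: pigeonhole gives `x_n ∈ ∂ⁱⁿΛ(n)` with `P(0 ⟷ x_n in Λ(n)) ≥ θ/|∂ⁱⁿΛ(n)|`;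
   Lemma 7.1 (`k = 0`) and Theorem 1.1 give `P(two-arms(Λ(n), 0, x_n, ℓ_n)) ≤ K n^{3d−1} n^{−α₀γ}
   → 0`, so Lemma 10.1 yields `P(0 ⟷ x_n in Λ(n + ℓ_n)) ≥ θ²/2` for `n ≥ N`.
2. `axis_estimate`: reflecting through the face containing `x_n` and gluing (Harris),
   `P(0 ⟷ ±2n e_j in Λ(3n + ℓ_n)) ≥ θ⁴/4` for all axes `j` (signed coordinate permutations).
3. `axis_estimate_all`: all multiples `k e_j`, `|k| ≤ 2n`, inside `Λ(3n + ℓ_n)` with a constant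
   `ρ₁ = min(p θ⁴/4, p^{|Λ(2N)|})` (box monotonicity in the scale, one-site boost for odd `k`,
   brute positivity `P ≥ p^{|Λ|}` below `2N`).
4. `chain_estimate`: adjusting one coordinate at a time (translation invariance + Harris),
   `P(0 ⟷ z in Λ(5n + ℓ_n)) ≥ p ρ₁^d` for `z ∈ Λ(2n)`.
5. `Cerf2015_thm_1_3_of_facts`: for `x, y ∈ Λ(n)` translate by `x` (`y − x ∈ Λ(2n)`), and use
   `Λ(6n + ℓ_n) ⊆ Λ(⌈n^α⌉)` for `n ≥ N₁` (`exists_box_radius_le`); small `n`, and the degenerate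
   parameter `p = 1` (where Lemma 7.1 is not available), are covered by `P ≥ p^{|Λ(n)|}`.

The paper's boxes `Λ(4n + n^α) ⊆ Λ(6n + n^α)` "`⊆ Λ(n^α)`" silently use that `α > T(d)` is an
open condition; the auxiliary exponent `α₀` makes this explicit. No statement of `CerfBoxLRO` /
`CerfTwoArms` is modified.

## References

* R. Cerf, Ann. Probab. 43 (2015) 2458–2480, arXiv:1306.3105, §10 (p. 15), Thm 1.3 (p. 4).
* G. Grimmett, *Percolation*, 2nd ed., Springer 1999, Thm 2.4 (Harris–FKG), (2.7) (gluing).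
-/

namespace Literature.Probability.Percolation

section CritPerc

open MeasureTheory Filter Topology LatticeModels

variable {d : ℕ}

/-! #### Step 0: the parameter is positive -/

/-- At `p = 0` every site is closed, so `θ^site(0) = 0`. [folklore] -/
theorem siteTheta_bot {V : Type*} [Countable V] (G : SimpleGraph V) (x : V) : siteTheta G x 0 = 0 := by
  have hx : (∅ : SiteConfig V) ∉ sitePercolatesAt G x := by
    have : siteCluster G (∅ : SiteConfig V) x = ∅ := by
      ext y; simp [siteCluster]
    simp [sitePercolatesAt, this]
  simp only [siteTheta, sitePercolation, ProbabilityTheory.setBernoulli_zero, measureReal_def,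
    Measure.dirac_apply, Set.indicator_of_notMem hx, ENNReal.toReal_zero]

/-- `θ^site(p) > 0` forces `p > 0`. [folklore] -/
theorem pos_of_siteTheta_pos {V : Type*} [Countable V] (G : SimpleGraph V) (x : V) (p : unitInterval)
    (h : 0 < siteTheta G x p) : 0 < (p : ℝ) := by
  rcases p.2.1.lt_or_eq with hp | hp
  · exact hp
  · exfalso
    have : p = 0 := Subtype.ext hp.symm
    rw [this, siteTheta_bot] at h
    exact lt_irrefl _ h

/-! #### Symmetries applied to connection events in boxes -/

/-- Translation: `P_p(w ⟷ w + z in w + Λ(m)) = P_p(0 ⟷ z in Λ(m))`. [folklore] -/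
theorem real_siteConnIn_shift (p : unitInterval) (m : ℕ) (w z : Site d) :
    (sitePercolation (Site d) p).real
        (siteConnIn (zdGraph d) ↑((box d m).image (· + w)) w (z + w)) =
      (sitePercolation (Site d) p).real (siteConnIn (zdGraph d) ↑(box d m) 0 z) := by
  have := sitePercolation_real_siteConnIn_iso (zdShiftIso w) p (↑(box d m) : Set (Site d)) 0 z
  rw [zdShiftIso_image_box] at this
  simpa using this

/-- Signed permutations: `P_p(0 ⟷ g z in Λ(m)) = P_p(0 ⟷ z in Λ(m))`. [folklore] -/
theorem real_siteConnIn_signedPerm (p : unitInterval) (m : ℕ) (π : Equiv.Perm (Fin d))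
    (ε : Fin d → ℤˣ) (z : Site d) :
    (sitePercolation (Site d) p).real
        (siteConnIn (zdGraph d) ↑(box d m) 0 (Site.signedPerm π ε z)) =
      (sitePercolation (Site d) p).real (siteConnIn (zdGraph d) ↑(box d m) 0 z) := by
  have := sitePercolation_real_siteConnIn_iso (zdSignedPermIso π ε) p (↑(box d m) : Set (Site d)) 0 z
  rw [zdSignedPermIso_apply, zdSignedPermIso_apply, Site.signedPerm_zero] at this
  rwa [show ((zdSignedPermIso π ε) '' (↑(box d m) : Set (Site d))) = ↑(box d m) from
    signedPerm_image_box π ε m] at this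

/-- Axis points: `P_p(0 ⟷ (t a) e_j in Λ(m)) = P_p(0 ⟷ a e_i in Λ(m))` for a sign `t`. [folklore] -/
theorem real_siteConnIn_single_eq (p : unitInterval) (m : ℕ) (i j : Fin d) (t : ℤˣ) (a : ℤ) :
    (sitePercolation (Site d) p).real
        (siteConnIn (zdGraph d) ↑(box d m) 0 (Pi.single j ((t : ℤ) * a))) =
      (sitePercolation (Site d) p).real (siteConnIn (zdGraph d) ↑(box d m) 0 (Pi.single i a)) := by
  obtain ⟨π, ε, h⟩ := exists_signedPerm_single i j t a
  rw [← h, real_siteConnIn_signedPerm]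

/-- The reflection through the hyperplane `{z_i = x_i}` composed as (negate coordinate `i`, then
translate by `2 x_i e_i`): a graph automorphism of `ℤ^d` fixing `x`, sending `0` to `2 x_i e_i`
and `Λ(m)` to `2 x_i e_i + Λ(m)`. [folklore] -/
theorem exists_reflection (x : Site d) (i : Fin d) :
    ∃ φ : zdGraph d ≃g zdGraph d, φ 0 = Pi.single i (2 * x i) ∧ φ x = x ∧
      ∀ m : ℕ, φ '' (↑(box d m) : Set (Site d)) =
        ↑((box d m).image (· + Pi.single i (2 * x i))) := by
  classical
  refine ⟨(zdSignedPermIso (Equiv.refl _) (Function.update 1 i (-1))).trans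
    (zdShiftIso (Pi.single i (2 * x i))), ?_, ?_, ?_⟩
  · rw [RelIso.trans_apply, zdSignedPermIso_apply, Site.signedPerm_zero, zdShiftIso_apply, zero_add]
  · rw [RelIso.trans_apply, zdSignedPermIso_apply, zdShiftIso_apply]
    funext j
    simp only [Pi.add_apply, Site.signedPerm_apply, Equiv.refl_symm, Equiv.refl_apply]
    rcases eq_or_ne j i with rfl | hj
    · simp; ring
    · simp [hj]
  · intro m
    have hcoe : (((zdSignedPermIso (Equiv.refl _) (Function.update 1 i (-1))).trans
        (zdShiftIso (Pi.single i (2 * x i))) : zdGraph d ≃g zdGraph d) : Site d → Site d) =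
        (zdShiftIso (Pi.single i (2 * x i))) ∘
          (Site.signedPerm (Equiv.refl _) (Function.update 1 i (-1))) := rfl
    rw [hcoe, Set.image_comp, signedPerm_image_box, zdShiftIso_image_box]

/-- Reflection invariance: for `x` with `P_p(0 ⟷ x in Λ(m)) = P_p(x ⟷ 2x_i e_i in 2x_i e_i + Λ(m))`.
[folklore] -/
theorem real_siteConnIn_reflect (p : unitInterval) (m : ℕ) (x : Site d) (i : Fin d) :
    (sitePercolation (Site d) p).real
        (siteConnIn (zdGraph d) ↑((box d m).image (· + Pi.single i (2 * x i))) x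
          (Pi.single i (2 * x i))) =
      (sitePercolation (Site d) p).real (siteConnIn (zdGraph d) ↑(box d m) 0 x) := by
  obtain ⟨φ, h0, hx, hbox⟩ := exists_reflection x i
  have := sitePercolation_real_siteConnIn_iso φ p (↑(box d m) : Set (Site d)) 0 x
  rw [hbox m, h0, hx, siteConnIn_comm] at this
  exact this


/-! #### Exponent bookkeeping -/

/-- The denominators in Cerf's exponents are positive for `d ≥ 1`. [folklore] -/
theorem cerf_denom_pos (hd : 1 ≤ d) :
    0 < 2 * (d : ℝ) ^ 2 + 3 * d - 3 ∧ 0 < 4 * (d : ℝ) ^ 2 + 5 * d - 5 := by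
  have hd' : (1 : ℝ) ≤ d := by exact_mod_cast hd
  constructor <;> nlinarith

/-- `γ_∞ > 0`. [folklore] -/
theorem cerfTwoArmsExponent_pos (hd : 1 ≤ d) : 0 < cerfTwoArmsExponent d := by
  obtain ⟨h1, h2⟩ := cerf_denom_pos hd
  exact div_pos h1 h2

/-- Cerf's threshold `T(d) = (4d²+5d−5)(3d−1)/(2d²+3d−3)` equals `(3d−1)/γ_∞` and exceeds `1`.
[cite: Cerf2015, Thm 1.3] -/
theorem cerf_threshold_eq (hd : 1 ≤ d) :
    ((4 * (d : ℝ) ^ 2 + 5 * d - 5) * (3 * d - 1)) / (2 * (d : ℝ) ^ 2 + 3 * d - 3) =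
      (3 * (d : ℝ) - 1) / cerfTwoArmsExponent d := by
  obtain ⟨h1, h2⟩ := cerf_denom_pos hd
  unfold cerfTwoArmsExponent
  field_simp

/-- `T(d) > 1` for `d ≥ 1`. [folklore] -/
theorem one_lt_cerf_threshold (hd : 1 ≤ d) :
    1 < ((4 * (d : ℝ) ^ 2 + 5 * d - 5) * (3 * d - 1)) / (2 * (d : ℝ) ^ 2 + 3 * d - 3) := by
  obtain ⟨h1, h2⟩ := cerf_denom_pos hd
  have hd' : (1 : ℝ) ≤ d := by exact_mod_cast hd
  rw [one_lt_div h1]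
  nlinarith

/-- Choice of the two-arms exponent `γ ∈ [0, γ_∞)` with `α₀ γ > 3d − 1`, possible exactly when
`α₀ > T(d)` (Cerf 2015, §10: "Let `α` be such that `α > (4d²+5d−5)(3d−1)/(2d²+3d−3)`").
[cite: Cerf2015, §10] -/
theorem exists_gamma (hd : 1 ≤ d) {α₀ : ℝ}
    (hα₀ : ((4 * (d : ℝ) ^ 2 + 5 * d - 5) * (3 * d - 1)) / (2 * (d : ℝ) ^ 2 + 3 * d - 3) < α₀) :
    ∃ γ : ℝ, 0 ≤ γ ∧ γ < cerfTwoArmsExponent d ∧ 3 * (d : ℝ) - 1 < α₀ * γ := by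
  have hγ := cerfTwoArmsExponent_pos hd
  have hT := one_lt_cerf_threshold hd
  rw [cerf_threshold_eq hd] at hα₀ hT
  have hα₀pos : 0 < α₀ := by linarith
  have hd' : (1 : ℝ) ≤ d := by exact_mod_cast hd
  have h3d : 0 < 3 * (d : ℝ) - 1 := by linarith
  -- (3d-1)/α₀ < γ_∞
  have hkey : (3 * (d : ℝ) - 1) / α₀ < cerfTwoArmsExponent d := by
    rw [div_lt_iff₀ hα₀pos]
    rw [div_lt_iff₀ hγ] at hα₀
    linarith [mul_comm α₀ (cerfTwoArmsExponent d)]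
  refine ⟨((3 * (d : ℝ) - 1) / α₀ + cerfTwoArmsExponent d) / 2, ?_, ?_, ?_⟩
  · have : 0 ≤ (3 * (d : ℝ) - 1) / α₀ := div_nonneg h3d.le hα₀pos.le
    linarith
  · linarith
  · have h1 : α₀ * (((3 * (d : ℝ) - 1) / α₀ + cerfTwoArmsExponent d) / 2) =
        ((3 * (d : ℝ) - 1) + α₀ * cerfTwoArmsExponent d) / 2 := by
      field_simp
    rw [h1]
    have : 3 * (d : ℝ) - 1 < α₀ * cerfTwoArmsExponent d := by
      have := (div_lt_iff₀ hα₀pos).1 hkey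
      linarith [mul_comm α₀ (cerfTwoArmsExponent d)]
    linarith

/-- Polynomial decay beats polynomial growth: `K n^{a} n^{−b} → 0` for `a < b`, in the form
"eventually below any `ε > 0`". [folklore] -/
theorem exists_nat_pow_mul_rpow_neg_lt {K a b ε : ℝ} (hab : a < b) (hε : 0 < ε) :
    ∃ N : ℕ, ∀ n : ℕ, N ≤ n → K * (n : ℝ) ^ a * (n : ℝ) ^ (-b) < ε := by
  have ht : Tendsto (fun n : ℕ => K * ((n : ℝ) ^ (-(b - a)))) atTop (𝓝 (K * 0)) :=
    ((tendsto_rpow_neg_atTop (by linarith)).comp tendsto_natCast_atTop_atTop).const_mul K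
  rw [mul_zero] at ht
  obtain ⟨N, hN⟩ := eventually_atTop.1 ((tendsto_order.1 ht).2 ε hε)
  refine ⟨max N 1, fun n hn => ?_⟩
  have hn1 : 1 ≤ n := le_of_max_le_right hn
  have hnpos : (0 : ℝ) < n := by exact_mod_cast hn1
  have := hN n (le_of_max_le_left hn)
  calc K * (n : ℝ) ^ a * (n : ℝ) ^ (-b) = K * (n : ℝ) ^ (-(b - a)) := by
        rw [mul_assoc, ← Real.rpow_add hnpos]; congr 2; ring
    _ < ε := this

/-! #### The main estimate of §10: `P(0 ⟷ x_n in Λ(n + n^{α₀})) ≥ θ²/2` -/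

/-- **§10, first half** (Cerf 2015, p. 15): from Lemma 7.1 (`k = 0`), the pigeonhole point
`x_n ∈ ∂ⁱⁿΛ(n)` with `P(0 ⟷ x_n in Λ(n)) ≥ θ/|∂ⁱⁿΛ(n)|`, Theorem 1.1 at `p` and Lemma 10.1:
for `α₀ > T(d)` and `n` large, `P(0 ⟷ x_n in Λ(n + ℓ_n)) ≥ θ²/2` with `ℓ_n = ⌈n^{α₀}⌉ + 1`.
[cite: Cerf2015, §10] -/
theorem main_estimate (hd : 2 ≤ d) (p : unitInterval) (hp0 : 0 < (p : ℝ)) (hp1 : (p : ℝ) < 1)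
    (hθ : 0 < siteTheta (zdGraph d) 0 p) (h71 : Cerf2015_lem_7_1) (h101 : Cerf2015_lem_10_1)
    (h11 : Cerf2015_thm_1_1_of_siteTheta_pos) {α₀ : ℝ}
    (hα₀ : ((4 * (d : ℝ) ^ 2 + 5 * d - 5) * (3 * d - 1)) / (2 * (d : ℝ) ^ 2 + 3 * d - 3) < α₀) :
    ∃ N : ℕ, 2 ≤ N ∧ ∀ n : ℕ, N ≤ n → ∃ x ∈ innerBoundary (zdGraph d) (box d n),
      siteTheta (zdGraph d) 0 p ^ 2 / 2 ≤ (sitePercolation (Site d) p).real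
        (siteConnIn (zdGraph d) ↑(box d (n + (⌈(n : ℝ) ^ α₀⌉₊ + 1))) 0 x) := by
  have hd1 : 1 ≤ d := le_trans (by norm_num) hd
  set θ := siteTheta (zdGraph d) 0 p with hθdef
  set μ := sitePercolation (Site d) p with hμ
  obtain ⟨C, hC⟩ := h71 d hd p hp0 hp1
  obtain ⟨γ, hγ0, hγ, hγα⟩ := exists_gamma hd1 hα₀
  obtain ⟨c, hc⟩ := h11 d hd p hθ γ hγ
  have hα₀1 : 1 < α₀ := lt_trans (one_lt_cerf_threshold hd1) hα₀
  -- constants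
  set C' := max C 0 with hC'
  set c' := max c 0 with hc'
  set K : ℝ := C' * c' * (2 * d * (3 : ℝ) ^ (d - 1)) / θ with hK
  have hε : 0 < θ ^ 2 / 2 := by positivity
  obtain ⟨N₀, hN₀⟩ := exists_nat_pow_mul_rpow_neg_lt (K := K) (a := ((2 * d + (d - 1) : ℕ) : ℝ))
    (b := α₀ * γ) (by push_cast [Nat.cast_sub hd1]; linarith) hε
  refine ⟨max N₀ 2, le_max_right _ _, fun n hn => ?_⟩
  have hn2 : 2 ≤ n := le_of_max_le_right hn
  have hn1 : 1 ≤ n := le_trans (by norm_num) hn2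
  have hnpos : (0 : ℝ) < n := by exact_mod_cast hn1
  set ℓ : ℕ := ⌈(n : ℝ) ^ α₀⌉₊ + 1 with hℓ
  have hℓ2 : 2 ≤ ℓ := by
    have : 1 ≤ ⌈(n : ℝ) ^ α₀⌉₊ := Nat.one_le_ceil_iff.2 (Real.rpow_pos_of_pos hnpos _)
    omega
  -- the pigeonhole point
  obtain ⟨x, hxbd, hxP⟩ := exists_innerBoundary_siteConnIn_ge (G := zdGraph d) p (box d n)
    (zero_mem_box d n) hθ
  have hxbox : x ∈ box d n := (mem_innerBoundary_iff.1 hxbd).1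
  refine ⟨x, hxbd, ?_⟩
  -- notation for the probabilities involved
  set b := μ.real (siteConnIn (zdGraph d) ↑(box d n) 0 x) with hb
  set q := μ.real (siteTwoArms d 0 ⌈(n : ℝ) ^ α₀⌉₊) with hq
  set a := μ.real (siteTwoArmsPair d n 0 x ℓ) with ha
  -- |∂ⁱⁿΛ(n)| ≤ 2d 3^{d-1} n^{d-1}
  have hcardpos : (0 : ℝ) < (innerBoundary (zdGraph d) (box d n)).card := by
    exact_mod_cast Finset.card_pos.2 ⟨x, hxbd⟩
  have hcard : ((innerBoundary (zdGraph d) (box d n)).card : ℝ) ≤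
      2 * d * (3 : ℝ) ^ (d - 1) * (n : ℝ) ^ (d - 1) := by
    have h1 : ((innerBoundary (zdGraph d) (box d n)).card : ℝ) ≤ 2 * d * (2 * n + 1 : ℝ) ^ (d - 1) := by
      exact_mod_cast card_innerBoundary_box_le (d := d) n
    have h2 : (2 * n + 1 : ℝ) ^ (d - 1) ≤ (3 * n : ℝ) ^ (d - 1) := by
      apply pow_le_pow_left₀ (by positivity)
      have : (1 : ℝ) ≤ n := by exact_mod_cast hn1
      linarith
    calc ((innerBoundary (zdGraph d) (box d n)).card : ℝ) ≤ 2 * d * (2 * n + 1 : ℝ) ^ (d - 1) := h1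
      _ ≤ 2 * d * (3 * n : ℝ) ^ (d - 1) := by gcongr
      _ = 2 * d * (3 : ℝ) ^ (d - 1) * (n : ℝ) ^ (d - 1) := by rw [mul_pow]; ring
  -- b ≥ θ / |∂| > 0
  have hb_ge : θ / (innerBoundary (zdGraph d) (box d n)).card ≤ b := hxP
  have hbpos : 0 < b := lt_of_lt_of_le (div_pos hθ hcardpos) hb_ge
  -- q ≤ c' n^{-α₀ γ}
  have hq_le : q ≤ c' * (n : ℝ) ^ (-(α₀ * γ)) := by
    have hceil1 : 1 ≤ ⌈(n : ℝ) ^ α₀⌉₊ := Nat.one_le_ceil_iff.2 (Real.rpow_pos_of_pos hnpos _)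
    have h1 : q ≤ c * (⌈(n : ℝ) ^ α₀⌉₊ : ℝ) ^ (-γ) := hc _ hceil1
    have h2 : (⌈(n : ℝ) ^ α₀⌉₊ : ℝ) ^ (-γ) ≤ ((n : ℝ) ^ α₀) ^ (-γ) :=
      Real.rpow_le_rpow_of_nonpos (Real.rpow_pos_of_pos hnpos _) (Nat.le_ceil _) (by linarith)
    have h3 : ((n : ℝ) ^ α₀) ^ (-γ) = (n : ℝ) ^ (-(α₀ * γ)) := by
      rw [← Real.rpow_mul hnpos.le]; congr 1; ring
    have h4 : 0 ≤ (⌈(n : ℝ) ^ α₀⌉₊ : ℝ) ^ (-γ) := Real.rpow_nonneg (by positivity) _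
    calc q ≤ c * (⌈(n : ℝ) ^ α₀⌉₊ : ℝ) ^ (-γ) := h1
      _ ≤ c' * (⌈(n : ℝ) ^ α₀⌉₊ : ℝ) ^ (-γ) := by gcongr; exact le_max_left _ _
      _ ≤ c' * ((n : ℝ) ^ α₀) ^ (-γ) := by gcongr
      _ = c' * (n : ℝ) ^ (-(α₀ * γ)) := by rw [h3]
  have hq0 : 0 ≤ q := measureReal_nonneg
  -- Lemma 7.1 with k = 0
  have h71' : a * b ≤ C' * (n : ℝ) ^ (2 * d) * q := by
    have := hC n hn1 0 ℓ (by omega) 0 (zero_mem_box d n) x hxbox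
    simp only [add_zero, Nat.cast_zero, Nat.sub_zero] at this
    have hℓ1 : ℓ - 1 = ⌈(n : ℝ) ^ α₀⌉₊ := by omega
    rw [hℓ1] at this
    calc a * b ≤ C * (n : ℝ) ^ (2 * d) * q := this
      _ ≤ C' * (n : ℝ) ^ (2 * d) * q := by gcongr; exact le_max_left _ _
  -- hence a ≤ K n^{2d} n^{d-1} n^{-α₀γ}
  have ha_le : a ≤ K * (n : ℝ) ^ ((2 * d + (d - 1) : ℕ) : ℝ) * (n : ℝ) ^ (-(α₀ * γ)) := by
    have step1 : a ≤ C' * (n : ℝ) ^ (2 * d) * q / b := by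
      rw [le_div_iff₀ hbpos]; exact h71'
    have step2 : C' * (n : ℝ) ^ (2 * d) * q / b ≤
        C' * (n : ℝ) ^ (2 * d) * q * ((innerBoundary (zdGraph d) (box d n)).card / θ) := by
      rw [div_eq_mul_inv]
      have hnum : 0 ≤ C' * (n : ℝ) ^ (2 * d) * q :=
        mul_nonneg (mul_nonneg (le_max_right _ _) (by positivity)) hq0
      have hinv : b⁻¹ ≤ (innerBoundary (zdGraph d) (box d n)).card / θ := by
        -- b⁻¹ ≤ |∂|/θ  since θ/|∂| ≤ b
        rw [inv_le_comm₀ hbpos (div_pos hcardpos hθ), inv_div]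
        exact hb_ge
      exact mul_le_mul_of_nonneg_left hinv hnum
    have step3 : C' * (n : ℝ) ^ (2 * d) * q * ((innerBoundary (zdGraph d) (box d n)).card / θ) ≤
        C' * (n : ℝ) ^ (2 * d) * (c' * (n : ℝ) ^ (-(α₀ * γ))) *
          (2 * d * (3 : ℝ) ^ (d - 1) * (n : ℝ) ^ (d - 1) / θ) := by
      gcongr
    have step4 : C' * (n : ℝ) ^ (2 * d) * (c' * (n : ℝ) ^ (-(α₀ * γ))) *
          (2 * d * (3 : ℝ) ^ (d - 1) * (n : ℝ) ^ (d - 1) / θ) =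
        K * (n : ℝ) ^ ((2 * d + (d - 1) : ℕ) : ℝ) * (n : ℝ) ^ (-(α₀ * γ)) := by
      rw [Real.rpow_natCast, pow_add, hK]
      field_simp
    linarith
  have hsmall : a < θ ^ 2 / 2 := lt_of_le_of_lt ha_le (hN₀ n (le_of_max_le_left hn))
  -- Lemma 10.1
  have h101' := h101 d hd p n ℓ hn2 hℓ2 0 (zero_mem_box d n) x hxbox
  change θ ^ 2 - a ≤ μ.real (siteConnIn (zdGraph d) ↑(box d (n + ℓ)) 0 x) at h101'
  linarith


/-! #### FKG gluing of connection probabilities -/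

/-- **FKG gluing** (Grimmett 1999, (2.7); Cerf 2015, §6/§10): for finite `S, S' ⊆ T`,
`P_p(x ⟷ y in S) · P_p(y ⟷ z in S') ≤ P_p(x ⟷ z in T)`. [folklore] -/
theorem real_siteConnIn_mul_le {V : Type*} (G : SimpleGraph V) (p : unitInterval)
    {S S' T : Finset V} (hS : S ⊆ T) (hS' : S' ⊆ T) (x y z : V) :
    (sitePercolation V p).real (siteConnIn G ↑S x y) *
        (sitePercolation V p).real (siteConnIn G ↑S' y z) ≤
      (sitePercolation V p).real (siteConnIn G ↑T x z) :=
  calc (sitePercolation V p).real (siteConnIn G ↑S x y) *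
        (sitePercolation V p).real (siteConnIn G ↑S' y z)
      ≤ (sitePercolation V p).real (siteConnIn G ↑S x y ∩ siteConnIn G ↑S' y z) :=
        sitePercolation_harris' p (determinedBy_siteConnIn G ↑S x y)
          (determinedBy_siteConnIn G ↑S' y z) (siteConnIn_isUpperSet G ↑S x y)
          (siteConnIn_isUpperSet G ↑S' y z)
    _ ≤ (sitePercolation V p).real (siteConnIn G ↑T x z) :=
        measureReal_mono (fun _ hω => siteConnIn_trans G (Finset.coe_subset.2 hS)
          (Finset.coe_subset.2 hS') hω.1 hω.2) (measure_ne_top _ _)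

/-- **One-step extension** (Harris with the increasing event `{w open}`; Cerf 2015, §10, p. 15:
"This implies further that … `P(0 ⟷ ke_1 in Λ(4n + n^α)) ≥ (p/4) θ(p)^4`"):
`p · P_p(x ⟷ v in S) ≤ P_p(x ⟷ w in S)` for `w ∈ S` adjacent to `v`. [folklore] -/
theorem real_siteConnIn_adj_le {V : Type*} (G : SimpleGraph V) (p : unitInterval) {S : Finset V}
    {x v w : V} (hvw : G.Adj v w) (hw : w ∈ S) :
    (p : ℝ) * (sitePercolation V p).real (siteConnIn G ↑S x v) ≤
      (sitePercolation V p).real (siteConnIn G ↑S x w) :=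
  calc (p : ℝ) * (sitePercolation V p).real (siteConnIn G ↑S x v)
      ≤ (sitePercolation V p).real (siteConnIn G ↑S x v ∩ {ω | w ∈ ω}) :=
        sitePercolation_real_inter_mem_ge p (determinedBy_siteConnIn G ↑S x v)
          (siteConnIn_isUpperSet G ↑S x v) w
    _ ≤ (sitePercolation V p).real (siteConnIn G ↑S x w) := by
        refine measureReal_mono (fun ω hω => ?_) (measure_ne_top _ _)
        obtain ⟨hxv, hwω⟩ := hω
        obtain ⟨_, hv, _, hvS, _⟩ := id hxv
        exact siteConnIn_trans G subset_rfl subset_rfl hxv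
          (mem_siteConnIn_of_adj G hv hwω hvS (Finset.mem_coe.2 hw) hvw)

/-- `{x ⟷ x in S} = {x open}` for `x ∈ S`. [folklore] -/
theorem siteConnIn_self_eq {V : Type*} (G : SimpleGraph V) {S : Set V} {x : V} (hxS : x ∈ S) :
    siteConnIn G S x x = {ω | x ∈ ω} :=
  Set.ext fun _ => ⟨fun h => h.1, fun h => mem_siteConnIn_self G h hxS⟩

/-- `a e_j ∈ Λ(M)` iff `|a| ≤ M` (the "if" direction). [folklore] -/
theorem single_mem_box {M : ℕ} (j : Fin d) {a : ℤ} (ha : |a| ≤ M) :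
    (Pi.single j a : Site d) ∈ box d M := by
  rw [mem_box]
  intro k
  rcases eq_or_ne k j with rfl | hk
  · rw [Pi.single_eq_same]; exact abs_le.1 ha
  · rw [Pi.single_eq_of_ne hk]
    constructor <;> linarith [abs_nonneg a]

/-- **Small boxes**: `p^{|Λ(n)|} ≤ P_p(x ⟷ y in Λ(M))` for `x, y ∈ Λ(n)`, `n ≤ M`. [folklore] -/
theorem pow_card_box_le_siteConnIn_of_le (p : unitInterval) {n M : ℕ} (h : n ≤ M) {x y : Site d}
    (hx : x ∈ box d n) (hy : y ∈ box d n) :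
    (p : ℝ) ^ (box d n).card ≤
      (sitePercolation (Site d) p).real (siteConnIn (zdGraph d) ↑(box d M) x y) :=
  (pow_card_box_le_siteConnIn p n hx hy).trans (measureReal_mono
    (siteConnIn_mono_set _ (Finset.coe_subset.2 (box_mono d h)) x y) (measure_ne_top _ _))

/-- `n ≤ ⌈n^α⌉` for `α ≥ 1`. [folklore] -/
theorem le_natCeil_rpow (n : ℕ) {α : ℝ} (hα : 1 ≤ α) : n ≤ ⌈(n : ℝ) ^ α⌉₊ := by
  rcases Nat.eq_zero_or_pos n with rfl | hn
  · exact Nat.zero_le _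
  · have hn1 : (1 : ℝ) ≤ n := by exact_mod_cast hn
    have h : (n : ℝ) ≤ (n : ℝ) ^ α := by
      conv_lhs => rw [← Real.rpow_one (n : ℝ)]
      exact Real.rpow_le_rpow_of_exponent_le hn1 hα
    exact_mod_cast h.trans (Nat.le_ceil _)

/-- Eventually `6n + ⌈n^{α₀}⌉ + 1 ≤ ⌈n^α⌉` when `1 ≤ α₀ < α`. [folklore] -/
theorem exists_box_radius_le {α₀ α : ℝ} (h1 : 1 ≤ α₀) (h : α₀ < α) :
    ∃ N₁ : ℕ, ∀ n : ℕ, N₁ ≤ n → 6 * n + (⌈(n : ℝ) ^ α₀⌉₊ + 1) ≤ ⌈(n : ℝ) ^ α⌉₊ := by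
  have ht : Tendsto (fun n : ℕ => (n : ℝ) ^ (α - α₀)) atTop atTop :=
    (tendsto_rpow_atTop (by linarith)).comp tendsto_natCast_atTop_atTop
  obtain ⟨N, hN⟩ := eventually_atTop.1 (ht.eventually_ge_atTop 9)
  refine ⟨max N 1, fun n hn => ?_⟩
  have hn1 : 1 ≤ n := le_of_max_le_right hn
  have hn1' : (1 : ℝ) ≤ n := by exact_mod_cast hn1
  have hnpos : (0 : ℝ) < n := by linarith
  have h9 : 9 ≤ (n : ℝ) ^ (α - α₀) := hN n (le_of_max_le_left hn)
  have hα₀n : (n : ℝ) ≤ (n : ℝ) ^ α₀ := by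
    conv_lhs => rw [← Real.rpow_one (n : ℝ)]
    exact Real.rpow_le_rpow_of_exponent_le hn1' h1
  have hsplit : (n : ℝ) ^ α = (n : ℝ) ^ α₀ * (n : ℝ) ^ (α - α₀) := by
    rw [← Real.rpow_add hnpos]; congr 1; ring
  have h0 : 0 ≤ (n : ℝ) ^ α₀ := Real.rpow_nonneg hnpos.le _
  have hmain : (n : ℝ) ^ α₀ + 6 * n + 2 ≤ (n : ℝ) ^ α := by
    rw [hsplit]; nlinarith
  have hceil₀ : (⌈(n : ℝ) ^ α₀⌉₊ : ℝ) < (n : ℝ) ^ α₀ + 1 := Nat.ceil_lt_add_one h0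
  have hceil : (n : ℝ) ^ α ≤ ⌈(n : ℝ) ^ α⌉₊ := Nat.le_ceil _
  have key : ((6 * n + (⌈(n : ℝ) ^ α₀⌉₊ + 1) : ℕ) : ℝ) ≤ (⌈(n : ℝ) ^ α⌉₊ : ℝ) := by
    push_cast; linarith
  exact_mod_cast key

/-! #### From the main estimate to all points of `Λ(2n)` (Cerf 2015, §10, p. 15) -/

/-- **§10, even axis points** (Cerf 2015, p. 15: "By symmetry and the FKG inequality, for `n`
large enough, `P(0 ⟷ 2ne_1 in Λ(4n + n^α)) ≥ … ≥ ¼ θ(p)^4`"; here in the box `Λ(3n + ℓ_n)`,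
`ℓ_n = ⌈n^{α₀}⌉ + 1`, for every axis and both signs, via the reflection fixing `x_n` and the
signed coordinate permutations). [cite: Cerf2015, §10] -/
theorem axis_estimate (hd : 2 ≤ d) (p : unitInterval) (hp0 : 0 < (p : ℝ)) (hp1 : (p : ℝ) < 1)
    (hθ : 0 < siteTheta (zdGraph d) 0 p) (h71 : Cerf2015_lem_7_1) (h101 : Cerf2015_lem_10_1)
    (h11 : Cerf2015_thm_1_1_of_siteTheta_pos) {α₀ : ℝ}
    (hα₀ : ((4 * (d : ℝ) ^ 2 + 5 * d - 5) * (3 * d - 1)) / (2 * (d : ℝ) ^ 2 + 3 * d - 3) < α₀) :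
    ∃ N : ℕ, 2 ≤ N ∧ ∀ n : ℕ, N ≤ n → ∀ (j : Fin d) (s : ℤˣ),
      siteTheta (zdGraph d) 0 p ^ 4 / 4 ≤ (sitePercolation (Site d) p).real
        (siteConnIn (zdGraph d) ↑(box d (3 * n + (⌈(n : ℝ) ^ α₀⌉₊ + 1))) 0
          (Pi.single j ((s : ℤ) * (2 * n)))) := by
  obtain ⟨N, hN2, hN⟩ := main_estimate hd p hp0 hp1 hθ h71 h101 h11 hα₀
  refine ⟨N, hN2, fun n hn j s => ?_⟩
  obtain ⟨x, hxbd, hxP⟩ := hN n hn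
  set θ := siteTheta (zdGraph d) 0 p with hθdef
  set μ := sitePercolation (Site d) p with hμ
  set ℓ : ℕ := ⌈(n : ℝ) ^ α₀⌉₊ + 1 with hℓ
  set m : ℕ := n + ℓ with hm
  obtain ⟨i, hi⟩ := exists_eq_of_mem_innerBoundary_box hxbd
  have h0n : (0 : ℤ) ≤ n := by positivity
  -- `v = 2 x_i e_i ∈ Λ(2n)`
  have hv : (Pi.single i (2 * x i) : Site d) ∈ box d (2 * n) := by
    refine single_mem_box i ?_
    rcases hi with h | h <;> rw [h, abs_le] <;> push_cast <;> constructor <;> linarith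
  -- reflection: `P(x ⟷ v in v + Λ(m)) = P(0 ⟷ x in Λ(m))`
  have hrefl := real_siteConnIn_reflect p m x i
  -- gluing inside `Λ(2n + m) = Λ(3n + ℓ)`
  have hT : 2 * n + m = 3 * n + ℓ := by omega
  have hsub : (box d m).image (· + Pi.single i (2 * x i)) ⊆ box d (3 * n + ℓ) := by
    rw [← hT]; exact image_add_box_subset hv
  have hmle : m ≤ 3 * n + ℓ := by omega
  have hS : box d m ⊆ box d (3 * n + ℓ) := box_mono d hmle
  have hglue := real_siteConnIn_mul_le (zdGraph d) p hS hsub 0 x (Pi.single i (2 * x i))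
  rw [hrefl] at hglue
  have h4 : θ ^ 4 / 4 = (θ ^ 2 / 2) * (θ ^ 2 / 2) := by ring
  have hsq : (θ ^ 2 / 2) * (θ ^ 2 / 2) ≤ μ.real (siteConnIn (zdGraph d) ↑(box d m) 0 x) *
      μ.real (siteConnIn (zdGraph d) ↑(box d m) 0 x) :=
    mul_le_mul hxP hxP (by positivity) measureReal_nonneg
  have key : θ ^ 4 / 4 ≤
      μ.real (siteConnIn (zdGraph d) ↑(box d (3 * n + ℓ)) 0 (Pi.single i (2 * x i))) := by
    rw [h4]; exact hsq.trans hglue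
  -- transport `2 x_i e_i` to `s (2n) e_j` by a signed coordinate permutation
  rcases hi with h | h
  · have hsym := real_siteConnIn_single_eq p (3 * n + ℓ) i j s (2 * x i)
    rw [h] at hsym key
    rw [hsym]; exact key
  · have hsym := real_siteConnIn_single_eq p (3 * n + ℓ) i j (-s) (2 * x i)
    rw [h] at hsym key
    have e : ((-s : ℤˣ) : ℤ) * (2 * -(n : ℤ)) = (s : ℤ) * (2 * n) := by push_cast; ring
    rw [e] at hsym
    rw [hsym]; exact key

/-- **§10, all axis points** (Cerf 2015, p. 15: "there exists `ρ > 0` such that `∀ n ≥ N`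
`∀ k ∈ {0,…,2n}` `P(0 ⟷ ke_1 in Λ(4n + n^α)) ≥ ρ` … By symmetry, we have the same lower
bounds for the probabilities of connections along the other axis directions"; here inside
`Λ(3n + ℓ_n)`, with `ρ₁ = min(p θ⁴/4, p^{|Λ(2N)|})`: even multiples from `axis_estimate` and
box monotonicity, odd ones by the one-site boost, small ones by brute positivity). [cite: Cerf2015, §10] -/
theorem axis_estimate_all (hd : 2 ≤ d) (p : unitInterval) (hp0 : 0 < (p : ℝ))
    (hp1 : (p : ℝ) < 1) (hθ : 0 < siteTheta (zdGraph d) 0 p) (h71 : Cerf2015_lem_7_1)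
    (h101 : Cerf2015_lem_10_1) (h11 : Cerf2015_thm_1_1_of_siteTheta_pos) {α₀ : ℝ}
    (hα₀ : ((4 * (d : ℝ) ^ 2 + 5 * d - 5) * (3 * d - 1)) / (2 * (d : ℝ) ^ 2 + 3 * d - 3) < α₀) :
    ∃ N : ℕ, 1 ≤ N ∧ ∃ ρ₁ : ℝ, 0 < ρ₁ ∧ ∀ n : ℕ, N ≤ n → ∀ (j : Fin d) (a : ℤ),
      |a| ≤ 2 * n → ρ₁ ≤ (sitePercolation (Site d) p).real
        (siteConnIn (zdGraph d) ↑(box d (3 * n + (⌈(n : ℝ) ^ α₀⌉₊ + 1))) 0 (Pi.single j a)) := by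
  obtain ⟨N, hN2, hN⟩ := axis_estimate hd p hp0 hp1 hθ h71 h101 h11 hα₀
  have hd1 : 1 ≤ d := le_trans (by norm_num) hd
  have hα₀0 : 0 ≤ α₀ := by linarith [one_lt_cerf_threshold hd1]
  set θ := siteTheta (zdGraph d) 0 p with hθdef
  set μ := sitePercolation (Site d) p with hμ
  have hp1' : (p : ℝ) ≤ 1 := p.2.2
  set ρ₁ : ℝ := min ((p : ℝ) * (θ ^ 4 / 4)) ((p : ℝ) ^ (box d (2 * N)).card) with hρ₁
  have hρ₁pos : 0 < ρ₁ := lt_min (by positivity) (by positivity)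
  refine ⟨N, by omega, ρ₁, hρ₁pos, fun n hn j a ha => ?_⟩
  -- write `a = t m` with a sign `t` and `m ∈ ℕ`, and remove the sign by symmetry
  obtain ⟨t, m, rfl⟩ : ∃ (t : ℤˣ) (m : ℕ), a = (t : ℤ) * m := by
    rcases Int.natAbs_eq a with h | h
    · exact ⟨1, a.natAbs, by simpa using h⟩
    · exact ⟨-1, a.natAbs, by simpa using h⟩
  have hm2n : m ≤ 2 * n := by
    have habs : |((t : ℤ) * m)| = m := by
      rcases Int.units_eq_one_or t with h | h <;> simp [h]
    rw [habs] at ha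
    exact_mod_cast ha
  rw [real_siteConnIn_single_eq p _ j j t]
  set R := 3 * n + (⌈(n : ℝ) ^ α₀⌉₊ + 1) with hR
  have hR2n : 2 * n ≤ R := by omega
  by_cases hsmall : m < 2 * N
  · -- small distances: brute positivity in `Λ(m) ⊆ Λ(R)`
    have hmem : (Pi.single j (m : ℤ) : Site d) ∈ box d m :=
      single_mem_box j (by rw [Nat.abs_cast])
    have hbox : box d m ⊆ box d (2 * N) := box_mono d hsmall.le
    calc ρ₁ ≤ (p : ℝ) ^ (box d (2 * N)).card := min_le_right _ _
      _ ≤ (p : ℝ) ^ (box d m).card :=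
          pow_le_pow_of_le_one p.2.1 hp1' (Finset.card_le_card hbox)
      _ ≤ μ.real (siteConnIn (zdGraph d) ↑(box d R) 0 (Pi.single j (m : ℤ))) :=
          pow_card_box_le_siteConnIn_of_le p (hm2n.trans hR2n) (zero_mem_box d m) hmem
  · push Not at hsmall
    -- even multiples `2k e_j`, `N ≤ k ≤ n`, from `axis_estimate` at scale `k`
    have heven : ∀ k : ℕ, N ≤ k → k ≤ n →
        θ ^ 4 / 4 ≤ μ.real (siteConnIn (zdGraph d) ↑(box d R) 0 (Pi.single j (2 * (k : ℤ)))) := by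
      intro k hNk hkn
      have h1 := hN k hNk j 1
      rw [Units.val_one, one_mul] at h1
      have hceil : ⌈(k : ℝ) ^ α₀⌉₊ ≤ ⌈(n : ℝ) ^ α₀⌉₊ :=
        Nat.ceil_mono (Real.rpow_le_rpow (Nat.cast_nonneg _) (by exact_mod_cast hkn) hα₀0)
      have hle : 3 * k + (⌈(k : ℝ) ^ α₀⌉₊ + 1) ≤ R := by omega
      have hbox : (↑(box d (3 * k + (⌈(k : ℝ) ^ α₀⌉₊ + 1))) : Set (Site d)) ⊆ ↑(box d R) :=
        Finset.coe_subset.2 (box_mono d hle)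
      exact h1.trans (measureReal_mono (siteConnIn_mono_set _ hbox _ _) (measure_ne_top _ _))
    obtain ⟨k, hk | hk⟩ := Nat.even_or_odd' m
    · -- `m = 2k`
      have hNk : N ≤ k := by omega
      have hkn : k ≤ n := by omega
      calc ρ₁ ≤ (p : ℝ) * (θ ^ 4 / 4) := min_le_left _ _
        _ ≤ 1 * (θ ^ 4 / 4) := by gcongr
        _ = θ ^ 4 / 4 := one_mul _
        _ ≤ μ.real (siteConnIn (zdGraph d) ↑(box d R) 0 (Pi.single j (m : ℤ))) := by
            rw [hk]; push_cast; exact heven k hNk hkn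
    · -- `m = 2k + 1`: one-site boost from `2k e_j`
      have hNk : N ≤ k := by omega
      have hkn : k ≤ n := by omega
      have hadj : (zdGraph d).Adj (Pi.single j (2 * (k : ℤ))) (Pi.single j ((m : ℕ) : ℤ)) := by
        rw [zdGraph_adj_iff]
        refine ⟨j, Or.inl ?_⟩
        rw [← Pi.single_add, hk]; push_cast; rfl
      have hmem : (Pi.single j ((m : ℕ) : ℤ) : Site d) ∈ box d R :=
        single_mem_box j (by rw [Nat.abs_cast]; exact_mod_cast hm2n.trans hR2n)
      calc ρ₁ ≤ (p : ℝ) * (θ ^ 4 / 4) := min_le_left _ _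
        _ ≤ (p : ℝ) * μ.real (siteConnIn (zdGraph d) ↑(box d R) 0 (Pi.single j (2 * (k : ℤ)))) := by
            gcongr; exact heven k hNk hkn
        _ ≤ μ.real (siteConnIn (zdGraph d) ↑(box d R) 0 (Pi.single j ((m : ℕ) : ℤ))) :=
            real_siteConnIn_adj_le _ p hadj hmem

/-- **§10, chain along the axes** (Cerf 2015, p. 15: "Using the FKG inequality, we conclude
that `∀ n ≥ 1` `∀ x ∈ Λ(2n)` `P(0 ⟷ x in Λ(6n + n^α)) ≥ ρ^d`"; here for `n ≥ N` inside
`Λ(5n + ℓ_n)` with the constant `p ρ₁^d`: adjust one coordinate at a time, translating the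
axis estimate to the current point and gluing with Harris). [cite: Cerf2015, §10] -/
theorem chain_estimate (hd : 2 ≤ d) (p : unitInterval) (hp0 : 0 < (p : ℝ)) (hp1 : (p : ℝ) < 1)
    (hθ : 0 < siteTheta (zdGraph d) 0 p) (h71 : Cerf2015_lem_7_1) (h101 : Cerf2015_lem_10_1)
    (h11 : Cerf2015_thm_1_1_of_siteTheta_pos) {α₀ : ℝ}
    (hα₀ : ((4 * (d : ℝ) ^ 2 + 5 * d - 5) * (3 * d - 1)) / (2 * (d : ℝ) ^ 2 + 3 * d - 3) < α₀) :
    ∃ N : ℕ, 1 ≤ N ∧ ∃ ρ : ℝ, 0 < ρ ∧ ∀ n : ℕ, N ≤ n → ∀ z ∈ box d (2 * n),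
      ρ ≤ (sitePercolation (Site d) p).real
        (siteConnIn (zdGraph d) ↑(box d (2 * n + (3 * n + (⌈(n : ℝ) ^ α₀⌉₊ + 1)))) 0 z) := by
  obtain ⟨N, hN1, ρ₁, hρ₁, hN⟩ := axis_estimate_all hd p hp0 hp1 hθ h71 h101 h11 hα₀
  refine ⟨N, hN1, (p : ℝ) * ρ₁ ^ d, by positivity, fun n hn z hz => ?_⟩
  set μ := sitePercolation (Site d) p with hμ
  set R := 3 * n + (⌈(n : ℝ) ^ α₀⌉₊ + 1) with hR
  -- induction over the set `S` of coordinates already adjusted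
  suffices H : ∀ S : Finset (Fin d), (p : ℝ) * ρ₁ ^ S.card ≤
      μ.real (siteConnIn (zdGraph d) ↑(box d (2 * n + R)) 0 (S.piecewise z 0)) by
    have := H Finset.univ
    rwa [Finset.card_univ, Fintype.card_fin, Finset.piecewise_univ] at this
  intro S
  induction S using Finset.induction_on with
  | empty =>
    rw [Finset.card_empty, pow_zero, mul_one, Finset.piecewise_empty,
      siteConnIn_self_eq (zdGraph d) (Finset.mem_coe.2 (zero_mem_box d _)),
      sitePercolation_real_mem]
  | insert j S hj ih =>
    have hzS : S.piecewise z 0 ∈ box d (2 * n) := by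
      rw [mem_box] at hz ⊢
      intro i
      by_cases hi : i ∈ S
      · rw [Finset.piecewise_eq_of_mem _ _ _ hi]; exact hz i
      · rw [Finset.piecewise_eq_of_notMem _ _ _ hi, Pi.zero_apply]
        constructor <;> linarith [(hz i).1, (hz i).2]
    have hstep : (insert j S).piecewise z 0 = Pi.single j (z j) + S.piecewise z 0 := by
      funext i
      rcases eq_or_ne i j with rfl | hij
      · rw [Finset.piecewise_eq_of_mem _ _ _ (Finset.mem_insert_self _ _), Pi.add_apply,
          Pi.single_eq_same, Finset.piecewise_eq_of_notMem _ _ _ hj, Pi.zero_apply, add_zero]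
      · rw [Pi.add_apply, Pi.single_eq_of_ne hij, zero_add]
        by_cases hi : i ∈ S
        · rw [Finset.piecewise_eq_of_mem _ _ _ hi,
            Finset.piecewise_eq_of_mem _ _ _ (Finset.mem_insert_of_mem hi)]
        · rw [Finset.piecewise_eq_of_notMem _ _ _ hi, Finset.piecewise_eq_of_notMem]
          simp [hij, hi]
    have hzj : |z j| ≤ 2 * n := abs_le.2 ((mem_box.1 hz) j)
    -- the axis connection, translated to the current point
    have hax := hN n hn j (z j) hzj
    rw [← real_siteConnIn_shift p R (S.piecewise z 0) (Pi.single j (z j))] at hax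
    -- gluing inside `Λ(2n + R)`
    have hglue := real_siteConnIn_mul_le (zdGraph d) p (S := box d (2 * n + R))
      (S' := (box d R).image (· + S.piecewise z 0)) (T := box d (2 * n + R)) subset_rfl
      (image_add_box_subset hzS) 0 (S.piecewise z 0) (Pi.single j (z j) + S.piecewise z 0)
    rw [Finset.card_insert_of_notMem hj, pow_succ, ← mul_assoc, hstep]
    exact (mul_le_mul ih hax hρ₁.le measureReal_nonneg).trans hglue

/-! #### Theorem 1.3 from Lemma 7.1, Lemma 10.1 and Theorem 1.1 (at `p` with `θ(p) > 0`) -/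

/-- **Cerf 2015, Theorem 1.3, assembled from its numbered inputs** (§10, p. 15): the two-arms
transfer inequality Lemma 7.1 (`Cerf2015_lem_7_1`, used with `k = 0`), the FKG lower bound
Lemma 10.1 (`Cerf2015_lem_10_1`) and the two-arms exponent bound Theorem 1.1 at the parameter
`p` (`Cerf2015_thm_1_1_of_siteTheta_pos`) imply finite-box long-range order
`inf_n inf_{x,y ∈ Λ(n)} P_p(x ⟷ y in Λ(⌈n^α⌉)) > 0` for every `α > (4d²+5d−5)(3d−1)/(2d²+3d−3)`.
The Harris–FKG inequality, the lattice symmetries, `θ ≤ Σ_{x ∈ ∂ⁱⁿΛ(n)} P(0 ⟷ x in Λ(n))` and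
`|∂ⁱⁿΛ(n)| ≤ 2d(2n+1)^{d−1}` used on p. 15 are proved in the tree
(`SitePercolationMeasure`, `SiteConnectionTools`). The proof runs §10 with an auxiliary
exponent `α₀ ∈ (T(d), α)` and absorbs the bounded factors `Λ(6n + n^{α₀}) ⊆ Λ(n^α)` for large
`n`; small `n` and the degenerate parameter `p = 1` are covered by `P ≥ p^{|Λ(n)|}`.
[cite: Cerf2015, Thm 1.3 and §10] -/
theorem Cerf2015_thm_1_3_of_facts (h71 : Cerf2015_lem_7_1) (h101 : Cerf2015_lem_10_1)
    (h11 : Cerf2015_thm_1_1_of_siteTheta_pos) : Cerf2015_thm_1_3 := by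
  intro d hd p hθ α hα
  have hd1 : 1 ≤ d := le_trans (by norm_num) hd
  have hp0 : 0 < (p : ℝ) := pos_of_siteTheta_pos (zdGraph d) 0 p hθ
  have hp1' : (p : ℝ) ≤ 1 := p.2.2
  have hT1 := one_lt_cerf_threshold hd1
  have hα1 : 1 ≤ α := by linarith
  -- fallback bound, valid for every `n`
  have small : ∀ n : ℕ, ∀ x ∈ box d n, ∀ y ∈ box d n,
      (p : ℝ) ^ (box d n).card ≤ (sitePercolation (Site d) p).real
        (siteConnIn (zdGraph d) ↑(box d ⌈(n : ℝ) ^ α⌉₊) x y) :=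
    fun n x hx y hy => pow_card_box_le_siteConnIn_of_le p (le_natCeil_rpow n hα1) hx hy
  rcases hp1'.lt_or_eq with hp1 | hp1
  · -- `0 < p < 1`: the argument of §10 with an auxiliary exponent `α₀ ∈ (T(d), α)`
    set α₀ : ℝ := (((4 * (d : ℝ) ^ 2 + 5 * d - 5) * (3 * d - 1)) /
      (2 * (d : ℝ) ^ 2 + 3 * d - 3) + α) / 2 with hα₀def
    have hα₀ : ((4 * (d : ℝ) ^ 2 + 5 * d - 5) * (3 * d - 1)) /
        (2 * (d : ℝ) ^ 2 + 3 * d - 3) < α₀ := by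
      rw [hα₀def]; linarith
    have hα₀α : α₀ < α := by rw [hα₀def]; linarith
    have hα₀1 : 1 ≤ α₀ := by linarith
    obtain ⟨N, hN1, ρ, hρ, hN⟩ := chain_estimate hd p hp0 hp1 hθ h71 h101 h11 hα₀
    obtain ⟨N₁, hN₁⟩ := exists_box_radius_le hα₀1 hα₀α
    set N₂ := max N N₁ with hN₂
    refine ⟨min ρ ((p : ℝ) ^ (box d N₂).card), lt_min hρ (by positivity),
      fun n hn x hx y hy => ?_⟩
    rcases Nat.lt_or_ge n N₂ with hlt | hge
    · have hbox : box d n ⊆ box d N₂ := box_mono d hlt.le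
      calc min ρ ((p : ℝ) ^ (box d N₂).card) ≤ (p : ℝ) ^ (box d N₂).card := min_le_right _ _
        _ ≤ (p : ℝ) ^ (box d n).card :=
            pow_le_pow_of_le_one p.2.1 hp1' (Finset.card_le_card hbox)
        _ ≤ _ := small n x hx y hy
    · have hnN : N ≤ n := le_trans (le_max_left _ _) hge
      have hnN₁ : N₁ ≤ n := le_trans (le_max_right _ _) hge
      -- `z = y - x ∈ Λ(2n)`
      have hz : y - x ∈ box d (2 * n) := by
        rw [mem_box] at hx hy ⊢
        intro i
        have h1 := hx i
        have h2 := hy i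
        simp only [Pi.sub_apply]
        push_cast
        constructor <;> linarith
      have hchain := hN n hnN (y - x) hz
      -- translate by `x`
      rw [← real_siteConnIn_shift p _ x (y - x), sub_add_cancel] at hchain
      have hrad : n + (2 * n + (3 * n + (⌈(n : ℝ) ^ α₀⌉₊ + 1))) ≤ ⌈(n : ℝ) ^ α⌉₊ := by
        have := hN₁ n hnN₁; omega
      have hbox : box d (n + (2 * n + (3 * n + (⌈(n : ℝ) ^ α₀⌉₊ + 1)))) ⊆ box d ⌈(n : ℝ) ^ α⌉₊ :=
        box_mono d hrad
      have hsub : (box d (2 * n + (3 * n + (⌈(n : ℝ) ^ α₀⌉₊ + 1)))).image (· + x) ⊆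
          box d ⌈(n : ℝ) ^ α⌉₊ :=
        (image_add_box_subset hx).trans hbox
      calc min ρ ((p : ℝ) ^ (box d N₂).card) ≤ ρ := min_le_left _ _
        _ ≤ _ := hchain
        _ ≤ _ := measureReal_mono (siteConnIn_mono_set _ (Finset.coe_subset.2 hsub) x y)
            (measure_ne_top _ _)
  · -- `p = 1`: every configuration is a.s. fully open
    refine ⟨1, one_pos, fun n _ x hx y hy => ?_⟩
    have := small n x hx y hy
    rwa [hp1, one_pow] at this

/-- **Cerf 2015, Theorem 1.3 for `d = 3` (`Λ(n^16)`), assembled from the same inputs**, through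
`Cerf2015_thm_1_3_three_of_thm_1_3`. [cite: Cerf2015, Thm 1.3 (case d = 3)] -/
theorem Cerf2015_thm_1_3_three_of_facts (h71 : Cerf2015_lem_7_1) (h101 : Cerf2015_lem_10_1)
    (h11 : Cerf2015_thm_1_1_of_siteTheta_pos) : Cerf2015_thm_1_3_three :=
  Cerf2015_thm_1_3_three_of_thm_1_3 (Cerf2015_thm_1_3_of_facts h71 h101 h11)

end CritPerc

end Literature.Probability.Percolation
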